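import Literature.AlgebraicGeometry.AbelianSchemes.LevelStructureOfHeckeQuotient
import Literature.AlgebraicGeometry.ModuliOfAbelianVarieties.SiegelHeckeKernelIndexSet
import Literature.AlgebraicGeometry.ModuliOfAbelianVarieties.HeckeDatumCoprime
import HarnessLib

/-!
# The `level` and `symplectic` fields of the Hecke isogeny quotient, kernel keyed on the residue matrix `r′ mod N′`
# ([Deligne1971TravauxShimura] 4.11–4.12, 4.16; [MumfordFogartyKirwan1994] Ch. 7 §3; [Lan2013] §1.3.6)

[Deligne1971TravauxShimura, Exemple 4.16 (p. 150) and 4.12 (b) (p. 149)]: an element `r′ ∈ K_δ(1) = GSp_δ(ẑ)` reduces to a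
compatible tower `(r′ mod M)_M` of `E_δ`-similitudes (★ `exists_similitudeTower`).  THIS FILE instantiates ★
`LevelStructure.exists_level_symplectic_of_heckeQuotient` (twist `ḡ = (r′ mod N′)⁻¹`, two towers, coprimality) at an adelic
representative `r′ ∈ K_δ(1)`: the socket-(B) assembler of the Hecke link feeds the kernel clause keyed on the residue MATRIX
`R′ = r′ mod N′` (as ★ `SiegelHeckeQuotientFamilyOfKernel` does: `R′ i j = integralAdeleResidue N′ (r′ i j)`), and the
towers, the `GL`-packaging `ḡ⁻¹ = R′` and `(ν, N) = 1` (★ `coprime_of_heckeDatum`) are built inside.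
* `similitudeTower_eq_residueHom` — the tower of ★ `exists_similitudeTower` at level `M` IS the value of the residue
  homomorphism `K_δ(1) → GL_{2g}(ℤ/M)` (so the towers of `r′` and `r′⁻¹` are mutually inverse);
* `LevelStructure.exists_level_symplectic_of_heckeQuotient_residue` — the statement.
Theorems only; cell hodgecm-mathlib, seat B-p04 (g17), (O-y) §2 sub-assembly (asks (1)+(2) of B-p21 (g14) 23:24:42Z).  HC_CM is proved
only modulo the 7 printed citations until rung 0 closes; this file discharges none of them.

## References
* [Deligne1971TravauxShimura] P. Deligne, *Travaux de Shimura* (1971), 4.11–4.12 (pp. 148–149), Exemple 4.16 (p. 150).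
* [MumfordFogartyKirwan1994] GIT (3rd ed.), Ch. 7 §1 Def. 7.1 (p. 129), §3 (p. 139).
* [Lan2013PELCompactifications] K.-W. Lan (2013), §1.3.6 Def. 1.3.6.2 (p. 80), Lemma 1.3.6.6 and Cor. 1.3.6.7 (pp. 81–82).
* [Milne2005ShimuraVarieties] J. S. Milne (2005), §6 p. 75.
-/

noncomputable section

universe u

open CategoryTheory CategoryTheory.Limits AlgebraicGeometry MonoidalCategory Matrix NumberField IsDedekindDomain
open scoped MonObj

namespace Literature.AlgebraicGeometry.AbelianSchemes

namespace AbelianSchemeOver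

open Literature.AlgebraicGeometry.Motives
open Literature.AlgebraicGeometry.ModuliOfAbelianVarieties
open Literature.NumberTheory.Adeles

/-! ### §1 The similitude tower is the residue homomorphism -/

/-- **The tower of ★ `exists_similitudeTower` at level `M` is the residue homomorphism's value**: if `Γ_M` has entries
`integralAdeleResidue M (γ i j)` then `Γ_M = ρ_M(γ)` for any hom `ρ_M : K_δ(1) → GL_{2g}(ℤ/M)` with residue entries (★
`exists_monoidHom_principalLevelSubgroup_one_integralAdeleResidue`). [cite: Deligne1971TravauxShimura, Exemple 4.16 p. 150] -/
theorem similitudeTower_eq_residueHom {g : ℕ} {δ : Fin g → ℕ} {M : ℕ} [NeZero M]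
    {ρ : principalLevelSubgroup δ 1 →* GL (Fin g ⊕ Fin g) (ZMod M)}
    (hρ : ∀ (x : principalLevelSubgroup δ 1) (i j : Fin g ⊕ Fin g)
      (h : (((x : gspFinAdelic δ) : GL (Fin g ⊕ Fin g) finAdeleQ) : Matrix (Fin g ⊕ Fin g) (Fin g ⊕ Fin g) finAdeleQ) i j ∈
        FiniteAdeleRing.integralAdeles (𝓞 ℚ) ℚ),
      ((ρ x : GL (Fin g ⊕ Fin g) (ZMod M)) : Matrix (Fin g ⊕ Fin g) (Fin g ⊕ Fin g) (ZMod M)) i j =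
        integralAdeleResidue M ⟨_, h⟩)
    {rA : gspFinAdelic δ} (hrA : rA ∈ principalLevelSubgroup δ 1) {ΓM : GL (Fin g ⊕ Fin g) (ZMod M)}
    (hΓM : ∀ (i j : Fin g ⊕ Fin g)
      (h : ((rA : GL (Fin g ⊕ Fin g) finAdeleQ) : Matrix (Fin g ⊕ Fin g) (Fin g ⊕ Fin g) finAdeleQ) i j ∈
        FiniteAdeleRing.integralAdeles (𝓞 ℚ) ℚ),
      (ΓM : Matrix (Fin g ⊕ Fin g) (Fin g ⊕ Fin g) (ZMod M)) i j = integralAdeleResidue M ⟨_, h⟩) :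
    ΓM = ρ ⟨rA, hrA⟩ := by
  refine Units.ext (Matrix.ext fun i j => ?_)
  have hint := entries_mem_integralAdeles_of_mem_principalLevelSubgroup_one hrA i j
  rw [hΓM i j hint, hρ ⟨rA, hrA⟩ i j hint]

/-! ### §2 The `level` and `symplectic` fields, kernel keyed on `R′ = r′ mod N′` -/

variable {S : Scheme.{u}} {A B : AbelianSchemeOver S}

/-- **THE `level` AND `symplectic` FIELDS OF THE HECKE ISOGENY QUOTIENT, adelic-representative form** (★
`exists_level_symplectic_of_heckeQuotient` with the towers of `r′⁻¹`, `r′ ∈ K_δ(1)` from ★ `exists_similitudeTower`, the twist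
`ḡ := (r′ mod Nν)⁻¹`, and `(ν, N) = 1` from ★ `coprime_of_heckeDatum`): inputs = the onto clause, the exact-kernel clause keyed
on the residue matrix `R′ = r′ mod Nν` (`x ≫ u = 1 ↔ ∃ c ∈ {c | (γ̄·R′)c = 0}, x = φ′(c)|s`), the integer Hecke datum, the
descent identity (b) in `.left`/`mulN` form, and the symplectic-liftability of `φ′`; output = a level-`N` structure `ψφ` on `B`
with `ψφᵢ = φ′ᵢ^ν ≫ u`, symplectic-liftable for `λ_B`. [cite: Deligne1971TravauxShimura, 4.11–4.12 pp. 148–149]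
[cite: MumfordFogartyKirwan1994, Ch. 7 §1 Definition 7.1 (p. 129) and §3 (p. 139)]
[cite: Lan2013PELCompactifications, §1.3.6 Def. 1.3.6.2 (p. 80), Lemma 1.3.6.6 and Cor. 1.3.6.7 (pp. 81–82)] -/
theorem LevelStructure.exists_level_symplectic_of_heckeQuotient_residue [IsCommMonObj A.X] [IsCommMonObj B.X]
    {g N ν : ℕ} {δ : Fin g → ℕ} (hg : 0 < g) (hδ : IsPolarizationType δ) (hN : N ≠ 0) (hν : ν ≠ 0)
    {φ' : A.LevelStructure g (N * ν)} {DA : A.DualPair} {polA : A.Polarization DA}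
    {DB : B.DualPair} {polB : B.Polarization DB}
    (u : A.X ⟶ B.X) [IsMonHom u] (hB : B.IsOfRelDim g)
    (γm γs : Matrix (Fin g ⊕ Fin g) (Fin g ⊕ Fin g) ℤ) (hγ : γm * γs = (ν : ℤ) • (1 : Matrix _ _ ℤ))
    (hγ' : γs * γm = (ν : ℤ) • (1 : Matrix _ _ ℤ)) (hsim : γsᵀ * typeForm δ * γs = (ν : ℤ) • typeForm δ)
    (hQA4 : ∀ k i, (N : ℤ) ∣ (γm - 1) k i)
    (r' : gspFinAdelic δ) (hr' : r' ∈ principalLevelSubgroup δ 1)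
    (R' : Matrix (Fin g ⊕ Fin g) (Fin g ⊕ Fin g) (ZMod (N * ν)))
    (hR' : haveI : NeZero (N * ν) := ⟨Nat.mul_ne_zero hN hν⟩; ∀ (i j : Fin g ⊕ Fin g)
      (h : ((r' : GL (Fin g ⊕ Fin g) finAdeleQ) : Matrix (Fin g ⊕ Fin g) (Fin g ⊕ Fin g) finAdeleQ) i j ∈
        FiniteAdeleRing.integralAdeles (𝓞 ℚ) ℚ), R' i j = integralAdeleResidue (N * ν) ⟨_, h⟩)
    (hsurjF : ∀ ⦃Ω : Type u⦄ [Field Ω] [IsAlgClosed Ω] (s : Spec (.of Ω) ⟶ S) (y : B.FibrePoints s),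
      ∃ x : A.FibrePoints s, x ≫ u = y)
    (hkerF : ∀ ⦃Ω : Type u⦄ [Field Ω] [IsAlgClosed Ω] (s : Spec (.of Ω) ⟶ S) (x : A.FibrePoints s), x ≫ u = 1 ↔
      ∃ c ∈ {c : Fin g ⊕ Fin g → ZMod (N * ν) | (γm.map (Int.castRingHom (ZMod (N * ν))) * R') *ᵥ c = 0},
        x = A.restrict s (φ'.section_ c))
    (hb : u.left ≫ polB.lam.left ≫ DualPair.dualIsogeny u DA DB = polA.lam.left ≫ (DA.hat.mulN ν).left)
    (h : φ'.IsSymplecticLiftable polA δ) :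
    ∃ ψφ : B.LevelStructure g N, (∀ i, ψφ.σ i = (φ'.σ i ^ ν) ≫ u) ∧ ψφ.IsSymplecticLiftable polB δ := by
  haveI : NeZero (N * ν) := ⟨Nat.mul_ne_zero hN hν⟩
  haveI : NeZero N := ⟨hN⟩
  -- coprimality from the datum
  have hcop : Nat.Coprime ν N := coprime_of_heckeDatum hg (fun i => (hδ.1 i).ne') hν γm γs hγ hsim hQA4
  -- the two similitude towers (of `r′` and of `r′⁻¹`) and the residue homomorphisms at levels `Nν`, `N`
  obtain ⟨Γ, cB, hres, hΓ, hcB, hsimB⟩ := exists_similitudeTower δ hδ hg hr'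
  obtain ⟨Γi, cA, hresi, hΓi, hcA, hsimA⟩ := exists_similitudeTower δ hδ hg (inv_mem hr')
  obtain ⟨ρ, hρ, -⟩ := exists_monoidHom_principalLevelSubgroup_one_integralAdeleResidue (N * ν) δ
  obtain ⟨ρN, hρN, -⟩ := exists_monoidHom_principalLevelSubgroup_one_integralAdeleResidue N δ
  have hΓρ : Γ (N * ν) = ρ ⟨r', hr'⟩ := similitudeTower_eq_residueHom hρ hr' (hres (N * ν))
  have hΓiρ : Γi (N * ν) = ρ (⟨r', hr'⟩⁻¹) := similitudeTower_eq_residueHom hρ (inv_mem hr') (hresi (N * ν))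
  have hΓNρ : Γ N = ρN ⟨r', hr'⟩ := similitudeTower_eq_residueHom hρN hr' (hres N)
  -- the twist `ḡ := Γi (Nν) = (r′ mod Nν)⁻¹`, with `ḡ⁻¹ = R′`
  have hgT : (Γi (N * ν))⁻¹ = Γ (N * ν) := by rw [hΓiρ, hΓρ, map_inv, inv_inv]
  have hgR : (((Γi (N * ν))⁻¹ : GL (Fin g ⊕ Fin g) (ZMod (N * ν))) : Matrix _ _ (ZMod (N * ν))) = R' := by
    rw [hgT]
    ext i j
    have hint := entries_mem_integralAdeles_of_mem_principalLevelSubgroup_one hr' i j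
    rw [hres (N * ν) i j hint, hR' i j hint]
  -- the target tower at level `N` is the reduction of `ḡ⁻¹`
  have hΓB_level : Γ N = (Matrix.GeneralLinearGroup.map (ZMod.castHom (⟨ν, rfl⟩ : N ∣ N * ν) (ZMod N)) (Γi (N * ν)))⁻¹ := by
    rw [← map_inv, hgT]
    refine Units.ext (Matrix.ext fun i j => ?_)
    have hint := entries_mem_integralAdeles_of_mem_principalLevelSubgroup_one hr' i j
    change (Γ N : Matrix _ _ (ZMod N)) i j =
      ZMod.castHom (⟨ν, rfl⟩ : N ∣ N * ν) (ZMod N) ((Γ (N * ν) : Matrix _ _ (ZMod (N * ν))) i j)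
    rw [hres N i j hint, hres (N * ν) i j hint, ← RingHom.comp_apply,
      castHom_comp_integralAdeleResidue (N * ν) (⟨ν, rfl⟩ : N ∣ N * ν)]
  -- assemble
  refine LevelStructure.exists_level_symplectic_of_heckeQuotient hN hν hcop u hB γm γs hγ hγ' hsim hQA4 (Γi (N * ν))
    Γi cA rfl hΓi hcA hsimA Γ cB hΓB_level hΓ hcB hsimB hsurjF (fun Ω _ _ s x => ?_) hb h
  rw [hgR]
  exact hkerF s x

end AbelianSchemeOver

end Literature.AlgebraicGeometry.AbelianSchemes

end
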